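import Summits.QuantumFields.BalabanUV.Gaps.D1IndexSymmetryDictionary

/-!
# `BalabanUV.Gaps.D1ParityOddFirstMoments` — cell pub-balaban-gaps, row (D1), seat g1-p1: WHAT THE END's REFLECTION BINDER `hR` (5.7) BUYS AT THE CELLS' LITERALS, EXACTLY —
# given the Ward binder `hW` (5.9) and the PROVED index symmetry (5.8) (GEN 14), the drift socket needs (5.7) only for FOUR parity-odd first moments per level

HONEST FRAMING (cell rule, page 1 of everything): [folklore] kernel algebra BY NAME — an1 gen 10's `Beta.OddMoments` (§2 the Ward route: `firstMoment_left_eq_zero_of_ward`,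
`firstMoment_right_eq_zero_of_ward`, `firstMoment_ward_antisymm`, `firstMoment_swap_of_indexSymmetric`; §1 `firstMoment_eq_zero_of_reflectionCovariant`), the β-lead's socket
`Beta.ScalewiseVectorSeam` (`hasSum_zero_of_ward`, `hU_of_scalewise`, `oneLoopDrift_of_vectorTails_evenVolume`, `readout122_*`, `splitOf`, `hessianTelescoping_iff_m2Tensor_sum`), an2∕an4's
`Beta.OneStepKernelFamily` (`D1Drift`, `D1Tel`, `D1Rep`, `d1Drift_of_D1Tel_D1Rep`, `flipK`), GEN 14's `indexSymmetric_flipK_TbalOf_JsBalAn1 ∕ _JsB12CombShSym` and `momentSummable_flipK_TbalOf`.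
WHAT IT RECORDS.  The wall's END `OneStepKernelFamily.d1Drift_of_D1Tel_D1Rep` displays FOUR row-D1 binders: `hW` (5.9) and `hR` (5.7) of the flipped step kernels, `D1Tel`, `D1Rep`.  The socket consumes
`hR` ONLY through the first-moment law (T1) `Σ_z z_ρ · T_j(c,e,z) = 0` (`ScalewiseVectorSeam.scalewiseData_of_printed_flip`).  Under `hW` + (5.8) + summable moments an1's Ward route kills every
IN-PLANE first moment and leaves a residue that is TOTALLY ANTISYMMETRIC in (left index, right index, weight direction) (§1): in four dimensions FOUR numbers per kernel,
`m₁(0,1,2)`, `m₁(0,1,3)`, `m₁(0,2,3)`, `m₁(1,2,3)` (`m₁(μ,ν,γ) := OddMoments.firstMoment P μ ν γ = Σ_z P_{μν}(z) z_γ`).  Since (5.8) is a THEOREM for the β-lead's pinned family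
`JsBalAn1` and for the b2b wall's (III′) literal (GEN 14), the END holds at those literals with `hR` REPLACED by «those four numbers vanish at every level» (§3, §4) — a hypothesis
implied by `hR` (`oddFree_of_reflectionCovariant`) and NOT implied by `hW` (an1: «for d ≥ 3 the out-of-plane odd moments are NOT killed by gauge invariance alone»).
[reading, not a theorem] the four numbers are the zero-momentum coefficients of the parity-odd gauge-invariant quadratic forms `ε^{αμγν} A_μ ∂_γ A_ν` (one per omitted axis `α`); any
ONE axis reflection among `{μ,ν,γ}` kills `m₁(μ,ν,γ)` (an1 §1), as would covariance under any odd axis permutation.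
WHAT IT IS NOT: `hW`, `D1Tel`, `D1Rep` and the four numbers remain HYPOTHESES — NO binder of row D1 is discharged; nothing of Bałaban's asserted ((5.7)–(5.9) are PRINTED for Bałaban's `Π`
[Balaban1987RG1 p. 293], used here as predicates on the cells' OWN literals); NO coefficient computed or signed; (D1) NOT discharged; 0∕4 row-D1 binders; NOT `BetaPertH`, NOT continuum, NOT Clay.
HONEST DEPENDENCY (b2b cell, verbatim): «continuum YM on T⁴ ⇐ BetaPertH ∧ nine spine estimates (0/9 proved); BetaPertH ⇐ (D1) ∧ (D4) ∧ CAP+tail; G-an2-4 gates asym, D1 and NE2/3/4.»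

CONTENT (all [folklore]; no `def`, 0 sorry): §1 generic (`P : B12Beta.Kernel d`): `eq_zero_of_antisymm₃` (a 3-tensor odd under the transpositions (12) and (13) and vanishing on increasing
triples vanishes), `firstMoment_swap13_of_ward` (the unconditional form of an1's antisymmetry), **`firstMoment_eq_zero_of_ward_indexSymmetric_oddFree`**, its `HasSum` form
**`hasSum_firstMoment_zero_of_ward_indexSymmetric_oddFree`** (= the socket's (T1)), `oddFree_of_reflectionCovariant` (`hR` ⟹ the four numbers), `oddFree_iff_four` (d = 4: the hypothesis IS
four equations); §2 generic step-jet data `Js` (any literal): **`d1Drift_of_D1Tel_D1Rep_oddFree`** — the END with `hR` replaced by (5.8) + the four numbers per level — and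
`d1Tel_iff_m2Tensor_sum_of_hW_oddFree`; §3 the β-lead's pinned family `JsBalAn1(r; c⃗; cE₂; cB; Tc)`: (5.8) discharged — **`d1Drift_JsBalAn1_of_D1Tel_D1Rep_oddFree`**, `hT1_TbalOf_JsBalAn1_of_hW_oddFree`,
`oddJet_flipK_TbalOf_JsBalAn1_of_hW`; §4 the same at the (III′) literal `JsB12CombShSym hLc N tabs cΛ cB` over every table record; §5 the pinned family's RESPONSE TOWERS (Engine C's objects,
GEN 12's `D1PinnedResponseTowers.TbalOf_JsBalAn1_dataDiff`): `firstMoment_flipK`, `firstMoment_sub`, **`firstMoment_flipK_TbalOf_JsBalAn1_dataDiff`** (parity-odd first moments are additive in the data),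
**`oddFree_dataDiff_of_members`** (the reduced hypothesis passes to the tower words — a NONZERO out-of-plane first moment of a border∕table tower member refutes it, hence `hR`, for one of the two members),
`firstMoment_dataDiff_eq_zero_of_hW_of_not_injective`.

Provenance: cell pub-balaban-gaps, seat g1-p1 GEN 15 (prover-pub-balaban-gaps-g1-p1-g15-0), 2026-08-25; imports `Gaps/D1IndexSymmetryDictionary` (p389565 ✓) only; no existing file touched.
-/

noncomputable section

open Literature.MathematicalPhysics.QuantumFieldTheory Balaban1983to89 Balaban1983to89.Beta Filter Topology
open OneStepResolventKernel (JetData)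
open ExpKernelCalculus (tadpole)
open OneStepKernelFamily (KInvStep TbalOf TshotOf flipK D1Drift D1Tel D1Rep hTA_TbalOf hasSum_flipK_iff hasSum_firstMoment_of_flipK)
open PolarizationSign (IndexSymmetric WardTransversal AxisReflectionCovariant MomentSummable)
open OddMoments (firstMoment zerothMoment oddJet firstMoment_left_eq_zero_of_ward firstMoment_right_eq_zero_of_ward firstMoment_ward_antisymm
  firstMoment_swap_of_indexSymmetric firstMoment_eq_zero_of_reflectionCovariant summable_mul_coord oddJet_eq_zero_of_ward)
open ScalewiseVectorSeam (hasSum_zero_of_ward hU_of_scalewise readout122 readout122_add readout122_m2Tensor oneShotFullSum_readout122_iff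
  oneLoopDrift_of_vectorTails_evenVolume splitOf oneShotSide hessianTelescoping_iff_m2Tensor_sum)
open DressedMomentNormalisation (EKer m2Tensor)
open DecimatedMomentSummable (AbsMoment₂)
open HidentScalewise (HessianTelescoping identityForm_trivial)
open Drift (OneLoopDrift)
open FlowStep FlowStepRuns DagBinding
open VectorTailsLoc (fam kfam)
open VectorLegVolumeAdapter (MvE)
open AffineAveraging (box toSite)
open AveragingMixedJetTables (vh₂SAt mixFFAt)
open AxialDressing (axDressK)
open BalabanStepW2 (T2Of)
open Summit.QuantumFields.BalabanUV.Beta.GAN24.T2RecursionAffine (vsym)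
open Summit.QuantumFields.BalabanUV.Gaps.D1PinnedResponseTowers (TbalOf_JsBalAn1_dataDiff)
open Summit.QuantumFields.BalabanUV.Beta.SymmetrisedStepJets (SymTables)
open Summit.QuantumFields.BalabanUV.Beta.MixedJetTablesPlug (JsBalAn1)
open Summit.QuantumFields.BalabanUV.Beta.CombChartJointEnd (JsB12CombShSym)
open Summit.QuantumFields.BalabanUV.Gaps.D1PinnedIndexSymmetry (indexSymmetric_flipK_TbalOf_JsBalAn1)
open Summit.QuantumFields.BalabanUV.Gaps.D1RecordIndexSymmetry (indexSymmetric_flipK_TbalOf_JsB12CombShSym)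
open Summit.QuantumFields.BalabanUV.Gaps.D1IndexSymmetryDictionary (momentSummable_flipK_TbalOf)

namespace Summit.QuantumFields.BalabanUV.Gaps.D1ParityOddFirstMoments

/-! ## §1 Generic: under (5.9) + (5.8) the first-moment tensor is totally antisymmetric; (T1) ⟺ its increasing components vanish -/

section Generic

variable {d : ℕ}

/-- [folklore] A real 3-tensor on a linear order that is ODD under the transposition of its first two slots and under the transposition of its first and third slots, and that
VANISHES ON INCREASING TRIPLES, vanishes identically (the two transpositions generate `S₃`; coincident slots are killed by oddness). -/
theorem eq_zero_of_antisymm₃ {ι : Type*} [LinearOrder ι] (m : ι → ι → ι → ℝ) (h12 : ∀ a b c, m a b c = -m b a c) (h13 : ∀ a b c, m a b c = -m c b a)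
    (hsort : ∀ a b c, a < b → b < c → m a b c = 0) (a b c : ι) : m a b c = 0 := by
  have hcyc : ∀ a b c, m a b c = m b c a := fun a b c => by rw [h13 a b c, h12 c b a, neg_neg]
  have hd12 : ∀ a c, m a a c = 0 := fun a c => by linarith [h12 a a c]
  have hd13 : ∀ a b, m a b a = 0 := fun a b => by linarith [h13 a b a]
  have hd23 : ∀ a b, m a b b = 0 := fun a b => by rw [hcyc]; exact hd12 b a
  have key : ∀ a b c, a < b → m a b c = 0 := by
    intro a b c hab
    rcases lt_trichotomy b c with hbc | rfl | hcb
    · exact hsort a b c hab hbc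
    · exact hd23 a b
    · rcases lt_trichotomy a c with hac | rfl | hca
      · have h23 : m a b c = -m a c b := by linarith [h13 a b c, hcyc a c b]
        rw [h23, hsort a c b hac hcb, neg_zero]
      · exact hd13 a b
      · rw [hcyc, hcyc, hsort c a b hca hab]
  rcases lt_trichotomy a b with hab | rfl | hba
  · exact key a b c hab
  · exact hd12 a c
  · rw [h12, key b a c hba, neg_zero]

/-- [folklore] an1's `firstMoment_ward_antisymm` WITHOUT the side condition `α ≠ β`: under (5.9) + summable third moments `Σ_z P_{αν}(z) z_β = −Σ_z P_{βν}(z) z_α` for ALL `α, β`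
(the case `α = β` is `firstMoment_left_eq_zero_of_ward`). -/
theorem firstMoment_swap13_of_ward {P : B12Beta.Kernel d} (hP : MomentSummable P 3) (hT : WardTransversal P) (α ν β : Fin d) :
    firstMoment P α ν β = -firstMoment P β ν α := by
  by_cases h : α = β
  · subst h
    rw [firstMoment_left_eq_zero_of_ward hP hT, neg_zero]
  · exact firstMoment_ward_antisymm hP hT h ν

/-- [folklore] Under (5.9) + (5.8) + summable third moments every first moment with two COINCIDENT labels among (left index, right index, weight direction) vanishes — the in-plane
moments `m₁(μ,ν,μ)`, `m₁(μ,ν,ν)` (an1 §2) and the diagonal-channel moments `m₁(μ,μ,γ)` ((5.8) alone). -/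
theorem firstMoment_eq_zero_of_ward_indexSymmetric_of_not_injective {P : B12Beta.Kernel d} (hP : MomentSummable P 3) (hT : WardTransversal P) (hS : IndexSymmetric P)
    {μ ν γ : Fin d} (h : μ = ν ∨ μ = γ ∨ ν = γ) : firstMoment P μ ν γ = 0 := by
  rcases h with rfl | rfl | rfl
  · linarith [firstMoment_swap_of_indexSymmetric hS μ μ γ]
  · exact firstMoment_left_eq_zero_of_ward hP hT μ ν
  · exact firstMoment_right_eq_zero_of_ward hP hT hS μ ν

/-- [folklore] **(5.9) + (5.8) + THE INCREASING PARITY-ODD MOMENTS ⟹ EVERY FIRST MOMENT VANISHES.**  Under the Ward identity, index symmetry and summable third moments the first-moment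
tensor `(μ,ν,γ) ↦ Σ_z P_{μν}(z) z_γ` is odd under (12) (`firstMoment_swap_of_indexSymmetric`) and under (13) (`firstMoment_swap13_of_ward`), hence totally antisymmetric; if its components
on increasing triples `a < b < c` vanish, it vanishes. -/
theorem firstMoment_eq_zero_of_ward_indexSymmetric_oddFree {P : B12Beta.Kernel d} (hP : MomentSummable P 3) (hT : WardTransversal P) (hS : IndexSymmetric P)
    (hodd : ∀ a b c : Fin d, a < b → b < c → firstMoment P a b c = 0) (μ ν γ : Fin d) : firstMoment P μ ν γ = 0 :=
  eq_zero_of_antisymm₃ (firstMoment P) (firstMoment_swap_of_indexSymmetric hS) (firstMoment_swap13_of_ward hP hT) hodd μ ν γ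

/-- [folklore] Conversely the increasing components are among the first moments: the reduced hypothesis is NECESSARY for (T1) (trivial). -/
theorem oddFree_of_firstMoment_eq_zero {P : B12Beta.Kernel d} (h : ∀ μ ν γ : Fin d, firstMoment P μ ν γ = 0) :
    ∀ a b c : Fin d, a < b → b < c → firstMoment P a b c = 0 := fun a b c _ _ => h a b c

/-- [folklore] **THE SOCKET's (T1) FROM (5.9) + (5.8) + THE INCREASING PARITY-ODD MOMENTS**, in the `HasSum` form `ScalewiseVectorSeam` consumes (cf. its
`hasSum_firstMoment_zero_of_reflection`, which gets the same from (5.7)). -/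
theorem hasSum_firstMoment_zero_of_ward_indexSymmetric_oddFree {P : B12Beta.Kernel d} (hP : MomentSummable P 3) (hT : WardTransversal P) (hS : IndexSymmetric P)
    (hodd : ∀ a b c : Fin d, a < b → b < c → firstMoment P a b c = 0) (c e ρ : Fin d) : HasSum (fun t : Fin d → ℤ => t ρ • P c e t) 0 := by
  have hfun : (fun t : Fin d → ℤ => t ρ • P c e t) = fun t => P c e t * (t ρ : ℝ) := by
    funext t; rw [zsmul_eq_mul, mul_comm]
  rw [hfun]
  have h := (summable_mul_coord hP c e ρ).hasSum
  have h0 : firstMoment P c e ρ = 0 := firstMoment_eq_zero_of_ward_indexSymmetric_oddFree hP hT hS hodd c e ρ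
  unfold OddMoments.firstMoment at h0
  rwa [h0] at h

/-- [folklore] **`hR` ⟹ THE REDUCED HYPOTHESIS**: under the printed reflection covariance (5.7) EVERY first moment vanishes (an1 §1, no Ward identity, no summability), in particular the
increasing parity-odd ones — so every END below with the reduced hypothesis generalises the END with `hR`. -/
theorem oddFree_of_reflectionCovariant {P : B12Beta.Kernel d} (hR : AxisReflectionCovariant P) :
    ∀ a b c : Fin d, a < b → b < c → firstMoment P a b c = 0 := fun a b c _ _ => firstMoment_eq_zero_of_reflectionCovariant hR a b c

/-- [folklore] In FOUR dimensions the reduced hypothesis IS four equations: `m₁(0,1,2) = m₁(0,1,3) = m₁(0,2,3) = m₁(1,2,3) = 0`. -/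
theorem oddFree_iff_four {P : B12Beta.Kernel 4} :
    (∀ a b c : Fin 4, a < b → b < c → firstMoment P a b c = 0) ↔
      firstMoment P 0 1 2 = 0 ∧ firstMoment P 0 1 3 = 0 ∧ firstMoment P 0 2 3 = 0 ∧ firstMoment P 1 2 3 = 0 := by
  have key : ∀ a b c : Fin 4, a < b → b < c →
      (a = 0 ∧ b = 1 ∧ c = 2) ∨ (a = 0 ∧ b = 1 ∧ c = 3) ∨ (a = 0 ∧ b = 2 ∧ c = 3) ∨ (a = 1 ∧ b = 2 ∧ c = 3) := by decide
  refine ⟨fun h => ⟨h 0 1 2 (by decide) (by decide), h 0 1 3 (by decide) (by decide), h 0 2 3 (by decide) (by decide), h 1 2 3 (by decide) (by decide)⟩,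
    fun h a b c hab hbc => ?_⟩
  obtain ⟨h1, h2, h3, h4⟩ := h
  rcases key a b c hab hbc with ⟨rfl, rfl, rfl⟩ | ⟨rfl, rfl, rfl⟩ | ⟨rfl, rfl, rfl⟩ | ⟨rfl, rfl, rfl⟩
  · exact h1
  · exact h2
  · exact h3
  · exact h4

end Generic

/-! ## §2 Generic step-jet data: the END with `hR` replaced by (5.8) + the four parity-odd numbers per level -/

section StepJets

variable {Lc : ℕ} [NeZero Lc] {L : Type*}

/-- [folklore] The socket's per-step data WITHOUT `hR`: (T0) from `hW` (`ScalewiseVectorSeam.hasSum_zero_of_ward`, flipped back by `OneStepKernelFamily.hasSum_flipK_iff`) and (T1) from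
`hW` + (5.8) + the increasing parity-odd moments (§1, flipped back by `hasSum_firstMoment_of_flipK`), for ANY step-jet family `Js` (summable moments of every order by an4's `hdec_TbalOf`,
GEN 14's `momentSummable_flipK_TbalOf`). -/
theorem scalewiseData_of_hW_indexSymmetric_oddFree (Js : ℕ → JetData 3 Lc)
    (hW : ∀ j, WardTransversal (flipK (TbalOf Lc Js j))) (hS : ∀ j, IndexSymmetric (flipK (TbalOf Lc Js j)))
    (hodd : ∀ j (a b c : Fin 4), a < b → b < c → firstMoment (flipK (TbalOf Lc Js j)) a b c = 0) :
    (∀ j c e, AbsMoment₂ (TbalOf Lc Js j c e)) ∧ (∀ j c e, HasSum (TbalOf Lc Js j c e) 0) ∧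
      (∀ j c e (ρ : Fin 4), HasSum (fun t : Fin 4 → ℤ => t ρ • TbalOf Lc Js j c e t) 0) :=
  ⟨hTA_TbalOf Js,
    fun j c e => hasSum_flipK_iff.mp (hasSum_zero_of_ward (momentSummable_flipK_TbalOf Js j 3) (hW j) c e),
    fun j c e ρ => hasSum_firstMoment_of_flipK
      (hasSum_firstMoment_zero_of_ward_indexSymmetric_oddFree (momentSummable_flipK_TbalOf Js j 3) (hW j) (hS j) (hodd j) c e ρ)⟩

/-- [folklore] **THE END's DRIFT WITH `hR` REPLACED** (any step-jet data `Js`, any composite data `Jc`): `OneStepKernelFamily.d1Drift_of_D1Tel_D1Rep` with the reflection binder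
`hR : ∀ j, AxisReflectionCovariant (flipK (TbalOf Lc Js j))` replaced by index symmetry (5.8) `hS` of the flipped step kernels and the vanishing of their increasing parity-odd first
moments `hodd` — four real numbers per level.  Same socket (`hU_of_scalewise` + `oneLoopDrift_of_vectorTails_evenVolume` at the split `splitOf β⁰`); `hW`, `hS`, `hodd`, `htel`, `hrep`
are HYPOTHESES about the jet data, never facts. -/
theorem d1Drift_of_D1Tel_D1Rep_oddFree (a : ℝ) (ha : 0 < a)
    (h12 : B5.Prop12Printed (fam (fun i : ℕ+ × ℕ => ((i.1 : ℕ+) : ℕ)) (fun i => i.1.pos) MvE a ha))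
    (h126 : B5.Kernel126_127Printed (kfam (fun i : ℕ+ × ℕ => ((i.1 : ℕ+) : ℕ)) MvE))
    {SL : Finset L} (hSL : SL.Nonempty) (k : L → Fin 4) {μ ν : Fin 4} (hμν : μ ≠ ν) {N : ℝ} (hN : N ≠ 0) (hL : 2 ≤ Lc)
    (Js : ℕ → JetData 3 Lc) (Jc : ∀ m : ℕ, JetData 3 (Lc ^ m))
    (hW : ∀ j, WardTransversal (flipK (TbalOf Lc Js j))) (hS : ∀ j, IndexSymmetric (flipK (TbalOf Lc Js j)))
    (hodd : ∀ j (a b c : Fin 4), a < b → b < c → firstMoment (flipK (TbalOf Lc Js j)) a b c = 0)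
    (htel : D1Tel Lc Js Jc)
    {cc : ℝ} {M : ℕ → ℕ} (hc : 1 ≤ cc) (hM : ∀ L : ℕ, 2 ≤ L → 1 ≤ M L ∧ (L : ℝ) ≤ cc * M L) (hML : ∀ L : ℕ, 2 ≤ L → M L ≤ L)
    (hrep : D1Rep Lc Jc N μ ν a SL k) : D1Drift Lc Js N μ ν := by
  obtain ⟨U, hU⟩ := hrep
  obtain ⟨hTA, hT0, hT1⟩ := scalewiseData_of_hW_indexSymmetric_oddFree Js hW hS hodd
  have hβ' : ∀ j, (splitOf fun j => B12Beta.secondMoment (TbalOf Lc Js j) μ ν).β0 j = readout122 μ ν (m2Tensor (TbalOf Lc Js j)) := fun j => by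
    rw [readout122_m2Tensor]; rfl
  exact oneLoopDrift_of_vectorTails_evenVolume a ha h12 h126 hSL k (splitOf fun j => B12Beta.secondMoment (TbalOf Lc Js j) μ ν) hμν hN hL hc hM hML
    (hU_of_scalewise hTA hT0 hT1 htel (readout122_add μ ν) hβ' (oneShotFullSum_readout122_iff.mpr hU)) (identityForm_trivial _)

/-- [folklore] The replaced END GENERALISES the printed-binder END: `hR` ⟹ `hodd` (`oddFree_of_reflectionCovariant`), so `d1Drift_of_D1Tel_D1Rep_oddFree` recovers
`OneStepKernelFamily.d1Drift_of_D1Tel_D1Rep` at every literal carrying (5.8). -/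
theorem d1Drift_of_D1Tel_D1Rep_of_hR_indexSymmetric (a : ℝ) (ha : 0 < a)
    (h12 : B5.Prop12Printed (fam (fun i : ℕ+ × ℕ => ((i.1 : ℕ+) : ℕ)) (fun i => i.1.pos) MvE a ha))
    (h126 : B5.Kernel126_127Printed (kfam (fun i : ℕ+ × ℕ => ((i.1 : ℕ+) : ℕ)) MvE))
    {SL : Finset L} (hSL : SL.Nonempty) (k : L → Fin 4) {μ ν : Fin 4} (hμν : μ ≠ ν) {N : ℝ} (hN : N ≠ 0) (hL : 2 ≤ Lc)
    (Js : ℕ → JetData 3 Lc) (Jc : ∀ m : ℕ, JetData 3 (Lc ^ m))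
    (hW : ∀ j, WardTransversal (flipK (TbalOf Lc Js j))) (hS : ∀ j, IndexSymmetric (flipK (TbalOf Lc Js j)))
    (hR : ∀ j, AxisReflectionCovariant (flipK (TbalOf Lc Js j)))
    (htel : D1Tel Lc Js Jc)
    {cc : ℝ} {M : ℕ → ℕ} (hc : 1 ≤ cc) (hM : ∀ L : ℕ, 2 ≤ L → 1 ≤ M L ∧ (L : ℝ) ≤ cc * M L) (hML : ∀ L : ℕ, 2 ≤ L → M L ≤ L)
    (hrep : D1Rep Lc Jc N μ ν a SL k) : D1Drift Lc Js N μ ν :=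
  d1Drift_of_D1Tel_D1Rep_oddFree a ha h12 h126 hSL k hμν hN hL Js Jc hW hS (fun j => oddFree_of_reflectionCovariant (hR j)) htel hc hM hML hrep

/-- [folklore] `D1Tel` REDUCED WITHOUT `hR`: under `hW` + (5.8) + the parity-odd numbers, Hessian telescoping of the step family onto the one-shot family IS second-moment-tensor
additivity `m2Tensor (TshotOf Lc Jc m) = Σ_{j<m} m2Tensor (TbalOf Lc Js j)` (`ScalewiseVectorSeam.hessianTelescoping_iff_m2Tensor_sum` with (T0)∕(T1) from §2). -/
theorem d1Tel_iff_m2Tensor_sum_of_hW_oddFree (Js : ℕ → JetData 3 Lc) (Jc : ∀ m : ℕ, JetData 3 (Lc ^ m))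
    (hW : ∀ j, WardTransversal (flipK (TbalOf Lc Js j))) (hS : ∀ j, IndexSymmetric (flipK (TbalOf Lc Js j)))
    (hodd : ∀ j (a b c : Fin 4), a < b → b < c → firstMoment (flipK (TbalOf Lc Js j)) a b c = 0) :
    D1Tel Lc Js Jc ↔ ∀ m : ℕ, 1 ≤ m → m2Tensor (TshotOf Lc Jc m) = ∑ j ∈ Finset.range m, m2Tensor (TbalOf Lc Js j) := by
  obtain ⟨hTA, hT0, hT1⟩ := scalewiseData_of_hW_indexSymmetric_oddFree Js hW hS hodd
  exact hessianTelescoping_iff_m2Tensor_sum hTA hT0 hT1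

end StepJets

/-! ## §3 The β-lead's pinned family `JsBalAn1(r; cE cVH cΛ; cE₂; cB; Tc)`: (5.8) is a theorem (GEN 14), so `hS` is discharged -/

section Pinned

variable {Lc : ℕ} [NeZero Lc] {r : Fin (3 + 1) → ℕ} {L : Type*}

/-- [folklore] AT THE PINNED LITERAL, under the END's Ward binder `hW` at level `j` ALONE (no `hR`): the parity-odd jet of every channel vanishes — zeroth moment and both in-plane first
moments (an1's `oddJet_eq_zero_of_ward` with (5.8) supplied by GEN 14's `indexSymmetric_flipK_TbalOf_JsBalAn1`). -/
theorem oddJet_flipK_TbalOf_JsBalAn1_of_hW (hLc : 1 ≤ Lc) (hr : r ∈ box (3 + 1) Lc) (cE cVH cΛ cE₂ cB : ℝ) (T : Fin 4 → Fin 4 → Fin 4 → Fin 4 → ℝ) (j : ℕ)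
    (hW : WardTransversal (flipK (TbalOf Lc (JsBalAn1 hLc hr cE cVH cΛ cE₂ cB T) j))) (μ ν : Fin 4) :
    oddJet (flipK (TbalOf Lc (JsBalAn1 hLc hr cE cVH cΛ cE₂ cB T) j)) μ ν = (0, 0, 0) :=
  oddJet_eq_zero_of_ward (momentSummable_flipK_TbalOf _ j 3) hW (indexSymmetric_flipK_TbalOf_JsBalAn1 hLc hr cE cVH cΛ cE₂ cB T j) μ ν

/-- [folklore] AT THE PINNED LITERAL, under `hW` at level `j` alone: every first moment with two coincident labels vanishes (in-plane and diagonal-channel moments) — what is left of (T1)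
is the totally antisymmetric part. -/
theorem firstMoment_flipK_TbalOf_JsBalAn1_of_hW_of_not_injective (hLc : 1 ≤ Lc) (hr : r ∈ box (3 + 1) Lc) (cE cVH cΛ cE₂ cB : ℝ) (T : Fin 4 → Fin 4 → Fin 4 → Fin 4 → ℝ)
    (j : ℕ) (hW : WardTransversal (flipK (TbalOf Lc (JsBalAn1 hLc hr cE cVH cΛ cE₂ cB T) j))) {μ ν γ : Fin 4} (h : μ = ν ∨ μ = γ ∨ ν = γ) :
    firstMoment (flipK (TbalOf Lc (JsBalAn1 hLc hr cE cVH cΛ cE₂ cB T) j)) μ ν γ = 0 :=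
  firstMoment_eq_zero_of_ward_indexSymmetric_of_not_injective (momentSummable_flipK_TbalOf _ j 3) hW (indexSymmetric_flipK_TbalOf_JsBalAn1 hLc hr cE cVH cΛ cE₂ cB T j) h

/-- [folklore] AT THE PINNED LITERAL: `hW` at level `j` + the four parity-odd numbers of that level ⟹ the socket's (T1) for the step kernel `TbalOf … j` itself. -/
theorem hT1_TbalOf_JsBalAn1_of_hW_oddFree (hLc : 1 ≤ Lc) (hr : r ∈ box (3 + 1) Lc) (cE cVH cΛ cE₂ cB : ℝ) (T : Fin 4 → Fin 4 → Fin 4 → Fin 4 → ℝ) (j : ℕ)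
    (hW : WardTransversal (flipK (TbalOf Lc (JsBalAn1 hLc hr cE cVH cΛ cE₂ cB T) j)))
    (hodd : ∀ a b c : Fin 4, a < b → b < c → firstMoment (flipK (TbalOf Lc (JsBalAn1 hLc hr cE cVH cΛ cE₂ cB T) j)) a b c = 0) (c e ρ : Fin 4) :
    HasSum (fun t : Fin 4 → ℤ => t ρ • TbalOf Lc (JsBalAn1 hLc hr cE cVH cΛ cE₂ cB T) j c e t) 0 :=
  hasSum_firstMoment_of_flipK (hasSum_firstMoment_zero_of_ward_indexSymmetric_oddFree (momentSummable_flipK_TbalOf _ j 3) hW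
    (indexSymmetric_flipK_TbalOf_JsBalAn1 hLc hr cE cVH cΛ cE₂ cB T j) hodd c e ρ)

/-- [folklore] **THE END AT THE PINNED LITERAL WITH THREE SYMMETRY-FREE BINDERS PLUS FOUR NUMBERS PER LEVEL**: for every member of the β-lead's pinned family (any box root, colour triple,
`cE₂`, `cB`, `Tc`) the wall's `d1Drift_of_D1Tel_D1Rep` holds with the reflection binder `hR` REPLACED by the vanishing of the four increasing parity-odd first moments of each flipped step
kernel — index symmetry (5.8) being GEN 14's theorem.  Displayed binders: `hW` (5.9), `hodd` (four reals per level), `D1Tel`, `D1Rep` (+ the cell's standing `h12`∕`h126` by name,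
`2 ≤ Lc`, `N ≠ 0`, window data).  Discharges nothing by itself. -/
theorem d1Drift_JsBalAn1_of_D1Tel_D1Rep_oddFree (a : ℝ) (ha : 0 < a)
    (h12 : B5.Prop12Printed (fam (fun i : ℕ+ × ℕ => ((i.1 : ℕ+) : ℕ)) (fun i => i.1.pos) MvE a ha))
    (h126 : B5.Kernel126_127Printed (kfam (fun i : ℕ+ × ℕ => ((i.1 : ℕ+) : ℕ)) MvE))
    {SL : Finset L} (hSL : SL.Nonempty) (k : L → Fin 4) {μ ν : Fin 4} (hμν : μ ≠ ν) {N : ℝ} (hN : N ≠ 0) (hL : 2 ≤ Lc)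
    (hLc : 1 ≤ Lc) (hr : r ∈ box (3 + 1) Lc) (cE cVH cΛ cE₂ cB : ℝ) (T : Fin 4 → Fin 4 → Fin 4 → Fin 4 → ℝ) (Jc : ∀ m : ℕ, JetData 3 (Lc ^ m))
    (hW : ∀ j, WardTransversal (flipK (TbalOf Lc (JsBalAn1 hLc hr cE cVH cΛ cE₂ cB T) j)))
    (hodd : ∀ j (a b c : Fin 4), a < b → b < c → firstMoment (flipK (TbalOf Lc (JsBalAn1 hLc hr cE cVH cΛ cE₂ cB T) j)) a b c = 0)
    (htel : D1Tel Lc (JsBalAn1 hLc hr cE cVH cΛ cE₂ cB T) Jc)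
    {cc : ℝ} {M : ℕ → ℕ} (hc : 1 ≤ cc) (hM : ∀ L : ℕ, 2 ≤ L → 1 ≤ M L ∧ (L : ℝ) ≤ cc * M L) (hML : ∀ L : ℕ, 2 ≤ L → M L ≤ L)
    (hrep : D1Rep Lc Jc N μ ν a SL k) : D1Drift Lc (JsBalAn1 hLc hr cE cVH cΛ cE₂ cB T) N μ ν :=
  d1Drift_of_D1Tel_D1Rep_oddFree a ha h12 h126 hSL k hμν hN hL _ Jc hW (indexSymmetric_flipK_TbalOf_JsBalAn1 hLc hr cE cVH cΛ cE₂ cB T) hodd htel hc hM hML hrep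

/-- [folklore] AT THE PINNED LITERAL, `D1Tel` without `hR`: under `hW` + the four numbers per level, `D1Tel ⟺` second-moment-tensor additivity. -/
theorem d1Tel_JsBalAn1_iff_m2Tensor_sum_of_hW_oddFree (hLc : 1 ≤ Lc) (hr : r ∈ box (3 + 1) Lc) (cE cVH cΛ cE₂ cB : ℝ) (T : Fin 4 → Fin 4 → Fin 4 → Fin 4 → ℝ)
    (Jc : ∀ m : ℕ, JetData 3 (Lc ^ m)) (hW : ∀ j, WardTransversal (flipK (TbalOf Lc (JsBalAn1 hLc hr cE cVH cΛ cE₂ cB T) j)))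
    (hodd : ∀ j (a b c : Fin 4), a < b → b < c → firstMoment (flipK (TbalOf Lc (JsBalAn1 hLc hr cE cVH cΛ cE₂ cB T) j)) a b c = 0) :
    D1Tel Lc (JsBalAn1 hLc hr cE cVH cΛ cE₂ cB T) Jc ↔
      ∀ m : ℕ, 1 ≤ m → m2Tensor (TshotOf Lc Jc m) = ∑ j ∈ Finset.range m, m2Tensor (TbalOf Lc (JsBalAn1 hLc hr cE cVH cΛ cE₂ cB T) j) :=
  d1Tel_iff_m2Tensor_sum_of_hW_oddFree _ Jc hW (indexSymmetric_flipK_TbalOf_JsBalAn1 hLc hr cE cVH cΛ cE₂ cB T) hodd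

end Pinned

/-! ## §4 The b2b wall's (III′) literal `JsB12CombShSym hLc N tabs cΛ cB` over every table record -/

section Record

variable {Lc : ℕ} [NeZero Lc] {L : Type*}

/-- [folklore] AT THE (III′) LITERAL (every table record), under `hW` at level `j` alone: the parity-odd jet of every channel vanishes. -/
theorem oddJet_flipK_TbalOf_JsB12CombShSym_of_hW (hLc : Odd Lc) (Nt : ℕ) (tabs : SymTables 3 Lc) (cΛ cB : ℝ) (j : ℕ)
    (hW : WardTransversal (flipK (TbalOf Lc (JsB12CombShSym hLc Nt tabs cΛ cB) j))) (μ ν : Fin 4) :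
    oddJet (flipK (TbalOf Lc (JsB12CombShSym hLc Nt tabs cΛ cB) j)) μ ν = (0, 0, 0) :=
  oddJet_eq_zero_of_ward (momentSummable_flipK_TbalOf _ j 3) hW (indexSymmetric_flipK_TbalOf_JsB12CombShSym hLc Nt tabs cΛ cB j) μ ν

/-- [folklore] AT THE (III′) LITERAL: `hW` at level `j` + the four parity-odd numbers ⟹ the socket's (T1) for `TbalOf … j`. -/
theorem hT1_TbalOf_JsB12CombShSym_of_hW_oddFree (hLc : Odd Lc) (Nt : ℕ) (tabs : SymTables 3 Lc) (cΛ cB : ℝ) (j : ℕ)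
    (hW : WardTransversal (flipK (TbalOf Lc (JsB12CombShSym hLc Nt tabs cΛ cB) j)))
    (hodd : ∀ a b c : Fin 4, a < b → b < c → firstMoment (flipK (TbalOf Lc (JsB12CombShSym hLc Nt tabs cΛ cB) j)) a b c = 0) (c e ρ : Fin 4) :
    HasSum (fun t : Fin 4 → ℤ => t ρ • TbalOf Lc (JsB12CombShSym hLc Nt tabs cΛ cB) j c e t) 0 :=
  hasSum_firstMoment_of_flipK (hasSum_firstMoment_zero_of_ward_indexSymmetric_oddFree (momentSummable_flipK_TbalOf _ j 3) hW
    (indexSymmetric_flipK_TbalOf_JsB12CombShSym hLc Nt tabs cΛ cB j) hodd c e ρ)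

/-- [folklore] **THE END AT THE (III′) LITERAL WITH `hR` REPLACED by four parity-odd numbers per level** (every table record `tabs`, table numeral `Nt`, colour numeral `N`; (5.8) is
GEN 14's `indexSymmetric_flipK_TbalOf_JsB12CombShSym`).  In particular at the LITERAL OF RECORD `JsB12CombShSym hLc N (symTablesAn1S2 3 Lc (2∕Lc⁴)) (2∕Lc⁴) (−Lc¹²∕4)`. -/
theorem d1Drift_JsB12CombShSym_of_D1Tel_D1Rep_oddFree (a : ℝ) (ha : 0 < a)
    (h12 : B5.Prop12Printed (fam (fun i : ℕ+ × ℕ => ((i.1 : ℕ+) : ℕ)) (fun i => i.1.pos) MvE a ha))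
    (h126 : B5.Kernel126_127Printed (kfam (fun i : ℕ+ × ℕ => ((i.1 : ℕ+) : ℕ)) MvE))
    {SL : Finset L} (hSL : SL.Nonempty) (k : L → Fin 4) {μ ν : Fin 4} (hμν : μ ≠ ν) {N : ℝ} (hN : N ≠ 0) (hL : 2 ≤ Lc)
    (hLc : Odd Lc) (Nt : ℕ) (tabs : SymTables 3 Lc) (cΛ cB : ℝ) (Jc : ∀ m : ℕ, JetData 3 (Lc ^ m))
    (hW : ∀ j, WardTransversal (flipK (TbalOf Lc (JsB12CombShSym hLc Nt tabs cΛ cB) j)))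
    (hodd : ∀ j (a b c : Fin 4), a < b → b < c → firstMoment (flipK (TbalOf Lc (JsB12CombShSym hLc Nt tabs cΛ cB) j)) a b c = 0)
    (htel : D1Tel Lc (JsB12CombShSym hLc Nt tabs cΛ cB) Jc)
    {cc : ℝ} {M : ℕ → ℕ} (hc : 1 ≤ cc) (hM : ∀ L : ℕ, 2 ≤ L → 1 ≤ M L ∧ (L : ℝ) ≤ cc * M L) (hML : ∀ L : ℕ, 2 ≤ L → M L ≤ L)
    (hrep : D1Rep Lc Jc N μ ν a SL k) : D1Drift Lc (JsB12CombShSym hLc Nt tabs cΛ cB) N μ ν :=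
  d1Drift_of_D1Tel_D1Rep_oddFree a ha h12 h126 hSL k hμν hN hL _ Jc hW (indexSymmetric_flipK_TbalOf_JsB12CombShSym hLc Nt tabs cΛ cB) hodd htel hc hM hML hrep

/-- [folklore] AT THE (III′) LITERAL, `D1Tel` without `hR`: under `hW` + the four numbers per level, `D1Tel ⟺` second-moment-tensor additivity. -/
theorem d1Tel_JsB12CombShSym_iff_m2Tensor_sum_of_hW_oddFree (hLc : Odd Lc) (Nt : ℕ) (tabs : SymTables 3 Lc) (cΛ cB : ℝ) (Jc : ∀ m : ℕ, JetData 3 (Lc ^ m))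
    (hW : ∀ j, WardTransversal (flipK (TbalOf Lc (JsB12CombShSym hLc Nt tabs cΛ cB) j)))
    (hodd : ∀ j (a b c : Fin 4), a < b → b < c → firstMoment (flipK (TbalOf Lc (JsB12CombShSym hLc Nt tabs cΛ cB) j)) a b c = 0) :
    D1Tel Lc (JsB12CombShSym hLc Nt tabs cΛ cB) Jc ↔
      ∀ m : ℕ, 1 ≤ m → m2Tensor (TshotOf Lc Jc m) = ∑ j ∈ Finset.range m, m2Tensor (TbalOf Lc (JsB12CombShSym hLc Nt tabs cΛ cB) j) :=
  d1Tel_iff_m2Tensor_sum_of_hW_oddFree _ Jc hW (indexSymmetric_flipK_TbalOf_JsB12CombShSym hLc Nt tabs cΛ cB) hodd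

end Record

/-! ## §5 The pinned family's RESPONSE TOWERS (Engine C's objects): parity-odd first moments are additive in the data, so a nonzero one for a tower member refutes the reduced hypothesis
## — hence `hR` — for one of the two members it compares -/

section Towers

variable {d : ℕ}

/-- [folklore] First moments change sign under the flip `z ↦ −z` (re-indexing; no summability needed) — Engine C's tower words are the UNFLIPPED kernels, the END's binders concern the
flipped ones; for «= 0» statements the convention is immaterial. -/
theorem firstMoment_flipK (P : B12Beta.Kernel d) (μ ν γ : Fin d) : firstMoment (flipK P) μ ν γ = -firstMoment P μ ν γ := by
  unfold OddMoments.firstMoment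
  rw [← (Equiv.neg (Fin d → ℤ)).tsum_eq (fun x => P μ ν x * (x γ : ℝ)), ← tsum_neg]
  refine tsum_congr fun x => ?_
  simp only [OneStepKernelFamily.flipK_apply, Equiv.neg_apply, Pi.neg_apply, Int.cast_neg]
  ring

/-- [folklore] First moments are ADDITIVE over kernels with summable moments. -/
theorem firstMoment_sub {P Q : B12Beta.Kernel d} (hP : MomentSummable P 3) (hQ : MomentSummable Q 3) (μ ν γ : Fin d) :
    firstMoment (fun a b z => P a b z - Q a b z) μ ν γ = firstMoment P μ ν γ - firstMoment Q μ ν γ := by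
  unfold OddMoments.firstMoment
  rw [← Summable.tsum_sub (summable_mul_coord hP μ ν γ) (summable_mul_coord hQ μ ν γ)]
  exact tsum_congr fun z => by ring

variable {Lc : ℕ} [NeZero Lc] {r : Fin (3 + 1) → ℕ}

/-- [folklore] **PARITY-ODD FIRST MOMENTS OF A DATA DIFFERENCE = THOSE OF THE PURE-TADPOLE TOWER WORD** (pinned family, two members with the same colour triple, any level; GEN 12's
`D1PinnedResponseTowers.TbalOf_JsBalAn1_dataDiff` + additivity): `m₁(flipK T_j(cB,Tc); a,b,c) − m₁(flipK T_j(cB′,Tc′); a,b,c) = m₁(flipK S_j; a,b,c)` with `S_j` the tower word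
`½·tadpole (Π K_j Π)(vsym K_j Lc D_j (μ,0;ν,·))`, `D_j := T2Of(cB,Tc) j − T2Of(cB′,Tc′) j` — Engine C's border tower (`cB − cB′ = 1`, `Tc = Tc′`) and table tower (`cB = cB′`). -/
theorem firstMoment_flipK_TbalOf_JsBalAn1_dataDiff (hLc : 1 ≤ Lc) (hr : r ∈ box (3 + 1) Lc) (cE cVH cΛ cE₂ cB cB' : ℝ) (T T' : Fin 4 → Fin 4 → Fin 4 → Fin 4 → ℝ) (j : ℕ)
    (a b c : Fin 4) :
    firstMoment (flipK (TbalOf Lc (JsBalAn1 hLc hr cE cVH cΛ cE₂ cB T) j)) a b c - firstMoment (flipK (TbalOf Lc (JsBalAn1 hLc hr cE cVH cΛ cE₂ cB' T') j)) a b c =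
      firstMoment (flipK (fun μ ν z => (1 / 2) * tadpole (axDressK Lc (KInvStep (d := 3) Lc j)) (vsym (KInvStep (d := 3) Lc j) Lc
        (T2Of 3 Lc cE cVH cΛ cE₂ cB T (vh₂SAt (toSite r) Lc) (mixFFAt (toSite r) Lc) j - T2Of 3 Lc cE cVH cΛ cE₂ cB' T' (vh₂SAt (toSite r) Lc) (mixFFAt (toSite r) Lc) j) μ 0 ν z)))
        a b c := by
  rw [← firstMoment_sub (momentSummable_flipK_TbalOf _ j 3) (momentSummable_flipK_TbalOf _ j 3)]
  unfold OddMoments.firstMoment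
  refine tsum_congr fun z => ?_
  simp only [OneStepKernelFamily.flipK_apply]
  rw [TbalOf_JsBalAn1_dataDiff hLc hr cE cVH cΛ cE₂ cB cB' T T' j a b (-z)]

/-- [folklore] **THE REDUCED HYPOTHESIS PASSES TO THE TOWERS**: if both members' flipped step kernels have vanishing increasing parity-odd first moments at level `j`, so has the tower word
`S_j` between them.  CONTRAPOSITIVE (the dictionary for an Engine-C first-derivative screen `m₁ = i∂Ŝ_j∕∂k_γ(0)`): ONE nonzero out-of-plane first moment of the border (or table) tower
at level `j` shows that the reduced hypothesis — hence the END's `hR` — FAILS for at least one of the two members compared. -/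
theorem oddFree_dataDiff_of_members (hLc : 1 ≤ Lc) (hr : r ∈ box (3 + 1) Lc) (cE cVH cΛ cE₂ cB cB' : ℝ) (T T' : Fin 4 → Fin 4 → Fin 4 → Fin 4 → ℝ) (j : ℕ)
    (hodd : ∀ a b c : Fin 4, a < b → b < c → firstMoment (flipK (TbalOf Lc (JsBalAn1 hLc hr cE cVH cΛ cE₂ cB T) j)) a b c = 0)
    (hodd' : ∀ a b c : Fin 4, a < b → b < c → firstMoment (flipK (TbalOf Lc (JsBalAn1 hLc hr cE cVH cΛ cE₂ cB' T') j)) a b c = 0)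
    (a b c : Fin 4) (hab : a < b) (hbc : b < c) :
    firstMoment (flipK (fun μ ν z => (1 / 2) * tadpole (axDressK Lc (KInvStep (d := 3) Lc j)) (vsym (KInvStep (d := 3) Lc j) Lc
        (T2Of 3 Lc cE cVH cΛ cE₂ cB T (vh₂SAt (toSite r) Lc) (mixFFAt (toSite r) Lc) j - T2Of 3 Lc cE cVH cΛ cE₂ cB' T' (vh₂SAt (toSite r) Lc) (mixFFAt (toSite r) Lc) j) μ 0 ν z)))
        a b c = 0 := by
  rw [← firstMoment_flipK_TbalOf_JsBalAn1_dataDiff hLc hr cE cVH cΛ cE₂ cB cB' T T' j a b c, hodd a b c hab hbc, hodd' a b c hab hbc, sub_zero]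

/-- [folklore] … and under `hW` for BOTH members at level `j` (no `hR`, no reduced hypothesis): the tower word's in-plane first moments and its diagonal-channel first moments vanish
(§3 for each member + additivity) — so only the four OUT-OF-PLANE first moments of a tower member carry information about `hR`. -/
theorem firstMoment_dataDiff_eq_zero_of_hW_of_not_injective (hLc : 1 ≤ Lc) (hr : r ∈ box (3 + 1) Lc) (cE cVH cΛ cE₂ cB cB' : ℝ) (T T' : Fin 4 → Fin 4 → Fin 4 → Fin 4 → ℝ)
    (j : ℕ) (hW : WardTransversal (flipK (TbalOf Lc (JsBalAn1 hLc hr cE cVH cΛ cE₂ cB T) j))) (hW' : WardTransversal (flipK (TbalOf Lc (JsBalAn1 hLc hr cE cVH cΛ cE₂ cB' T') j)))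
    {μ ν γ : Fin 4} (h : μ = ν ∨ μ = γ ∨ ν = γ) :
    firstMoment (flipK (fun a b z => (1 / 2) * tadpole (axDressK Lc (KInvStep (d := 3) Lc j)) (vsym (KInvStep (d := 3) Lc j) Lc
        (T2Of 3 Lc cE cVH cΛ cE₂ cB T (vh₂SAt (toSite r) Lc) (mixFFAt (toSite r) Lc) j - T2Of 3 Lc cE cVH cΛ cE₂ cB' T' (vh₂SAt (toSite r) Lc) (mixFFAt (toSite r) Lc) j) a 0 b z)))
        μ ν γ = 0 := by
  rw [← firstMoment_flipK_TbalOf_JsBalAn1_dataDiff hLc hr cE cVH cΛ cE₂ cB cB' T T' j μ ν γ,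
    firstMoment_flipK_TbalOf_JsBalAn1_of_hW_of_not_injective hLc hr cE cVH cΛ cE₂ cB T j hW h,
    firstMoment_flipK_TbalOf_JsBalAn1_of_hW_of_not_injective hLc hr cE cVH cΛ cE₂ cB' T' j hW' h, sub_zero]

end Towers

end Summit.QuantumFields.BalabanUV.Gaps.D1ParityOddFirstMoments

end
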